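import Summits.BirchSwinnertonDyer.BirchSwinnertonDyer.Theorems.SignedLowerHalvesKobayashiLowerHalfLargeImageKuriharaRigidityThm74Odd
import Summits.BirchSwinnertonDyer.Rank1Residual.Supersingular.KobayashiMainConjectureX7FouquetWanCrystalline
import Literature.NumberTheory.EllipticCurves.FouquetWan2021.KatoMainIdentityCrystallineOPEN
import HarnessLib

/-!
# The AUDITED Fouquet–Wan road (Thm 4.51, crystalline chain of §4.6) of crux `KobayashiLowerHalfLargeImage` with
# Kobayashi 7.4 IN THE KERNEL: the composite binder `FouquetWan2021_thm451_via_kobayashi74_OPEN` FROM the Literature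
# statement `FouquetWan2021.thm451_katoMainIdentity_OPEN` BY NAME, and its X7 ∧ Surj consumer on the finer inputs
# (route `SignedLowerHalves`, item stmt-BirchSwinnertonDyer-19001; cell `bsd-ssimc`, seat `bsd-line-slh-p1-w2` g2;
# `--supports … --as helper`)

WHAT. `FouquetWan2021_thm451_via_kobayashi74_OPEN` (`Rank1Residual/Supersingular/KobayashiMainConjectureX7FouquetWanCrystalline.lean`,
9 consumer files) is «FW arXiv:2107.13726 Thm 4.51 (PRE, §4.6 only, WITH Kato's (12.5.2)) ∘ Kobayashi 2003 Thm 7.4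
(PUB)» in the ± currency — "the chain the cell actually audits (W-lev-9)". As for the §5 composite (this seat,
p613135/p613756), the Kobayashi half is now the lead's KERNEL theorem at odd `p`
(`kobayashiMainConjecture_of_katoMainConjectureFrame_odd`, p612293), and FW Thm 4.51 is stated ALONE on Kato's
objects (`FouquetWan2021.thm451_katoMainIdentity_OPEN`, p615204): §1 derives the composite from {that statement,
Kobayashi Thm 1.2, the two period facts} BY NAME; §2 re-keys the road's X7 ∧ Surj consumer
(`X7.kobayashiMainConjecture_of_thm451_OPEN_of_surj`: Kato's (12.5.2) discharged by `ClassX7.imageContainsSL2_of_surj`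
at every odd `p`) on the finer inputs.

TRUST BASE of the audited FW road after this file (numbers, not adjectives): 1 PREPRINT claim stated on Kato's
objects + 3 PUBLISHED named facts; 0 composite binders; Kobayashi 7.4 nowhere on faith. HONEST FRAMING (cell
`bsd-ssimc`, D-0036/D-0074): TOOL THEOREMS ONLY — no definition, no named fact minted, no `sorry`, axioms standard;
CONDITIONAL on `hFW451` (a PREPRINT claim, never a theorem; flags `FW21-451-eta1-zeta-line`, `FW21-451-package`,
`A-KATO-3`, `FW21-Wan15`), `h12`, `h5`, `h3`; the class-wide crux and the route are NOT closed; nothing is booked;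
BSD is not proved by any of this. `--supports stmt-BirchSwinnertonDyer-19001 --as helper`.

References: [FouquetWan2021] Thm 4.41, Prop 4.42, §4.6.3, Thm 4.51 (p. 50); [Kobayashi2003] Thm 1.2, Thm 7.4 (p. 13);
[Kato2004Asterisque] (12.5.2); [Wuthrich2014] Lemma 20; [GreenbergVatsal2000] §3 Rem 3.4; [Mazur1978] Cor 4.1.
-/

set_option autoImplicit false
-- single-problem summit (D-0017): the doubled namespace component is by design
set_option linter.dupNamespace false

noncomputable section

open scoped Classical MatrixGroups ModularForm

open CongruenceSubgroup Field WeierstrassCurve Literature.NumberTheory.EllipticCurves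
  Literature.NumberTheory.EllipticCurves.ModularForms Literature.NumberTheory.GaloisRepresentations
  Literature.NumberTheory.EllipticCurves.Rank1Residual Summit.BirchSwinnertonDyer.Rank1Residual.Supersingular

namespace Summit.BirchSwinnertonDyer.BirchSwinnertonDyer.Theorems.KuriharaRigidity

/-! ## §1 The audited composite binder from named facts BY NAME -/

/-- **`FouquetWan2021_thm451_via_kobayashi74_OPEN` from NAMED inputs**: FW Thm 4.51 (with Kato's (12.5.2)) read on the
`η = 1` package (`hFW451 : FouquetWan2021.thm451_katoMainIdentity_OPEN`, [claim under-review] — never a theorem),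
Kobayashi Thm 1.2 (`h12`), the period facts (`h5`, `h3`) — by the lead's kernel Thm 7.4 at odd `p`
(`kobayashiMainConjecture_of_katoMainConjectureFrame_odd`) on the frame supplied by `hFW451`. CONDITIONAL; closes
nothing. [claim: FouquetWan2021, status: under-review] [cite: Kobayashi2003, Thm. 7.4 (p. 13), Thm. 1.2 (p. 2)]
[cite: Kato2004Asterisque, (12.5.2) in Thm. 12.5 (4) (p. 222)] [cite: GreenbergVatsal2000, §3, Remark 3.4] -/
theorem fouquetWan2021_thm451_via_kobayashi74_OPEN_of_facts
    (hFW451 : FouquetWan2021.thm451_katoMainIdentity_OPEN)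
    (h12 : Kobayashi2003.thm12_signedSelmerDual_finite_torsion)
    (h5 : realPeriodRat_eq_unit_mul_plusPeriod) (h3 : realPeriodRat_eq_unit_mul_plusPeriod_three) :
    FouquetWan2021_thm451_via_kobayashi74_OPEN := by
  intro W _ _ p _ hp2 hgood hap hirr himg hFWℓ ε
  haveI : ContinuousSMul ℤ_[p] (W.tateModule p) := TateModule.continuousSMul_padicInt
  haveI : Module.Free ℤ_[p] (W.tateModule p) := W.module_free_tateModule_holds p
  haveI : Module.Finite ℤ_[p] (W.tateModule p) := W.module_finite_tateModule_holds p
  refine kobayashiMainConjecture_of_katoMainConjectureFrame_odd W p h12 h5 h3 hp2 hgood hap hirr ε ?_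
  intro κ γ hκ hγ hγc _ f hf ϖ hϖ I Y
  exact hFW451 W p f ϖ κ γ hp2 hgood hap hf hϖ hκ hγ hγc hirr himg hFWℓ ε I Y

/-! ## §2 The X7 ∧ Surj consumer on the finer inputs -/

/-- **X7 ∩ {surj(p)} on the Fouquet–Wan locus, EVERY odd `p`: Kobayashi's main [C] for both signs on the FINER
inputs** — the road's `X7.kobayashiMainConjecture_of_thm451_OPEN_of_surj` (Kato's (12.5.2) discharged by
`ClassX7.imageContainsSL2_of_surj`, `E[p]` irreducible by `ClassX7.irr`) fed with §1. GRANTED `hFW451` (PREPRINT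
claim on Kato's objects), `h12`, `h5`, `h3` (PUBLISHED). CONDITIONAL; closes nothing.
[claim: FouquetWan2021, status: under-review] [cite: Kobayashi2003, Thm. 7.4 (p. 13)] [cite: Wuthrich2014, Lemma 20 (p. 399)] -/
theorem X7.kobayashiMainConjecture_of_fw451_katoMainIdentity_OPEN_of_surj
    (hFW451 : FouquetWan2021.thm451_katoMainIdentity_OPEN)
    (h12 : Kobayashi2003.thm12_signedSelmerDual_finite_torsion)
    (h5 : realPeriodRat_eq_unit_mul_plusPeriod) (h3 : realPeriodRat_eq_unit_mul_plusPeriod_three)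
    (W : WeierstrassCurve ℚ) [W.IsElliptic] [W.IsGloballyMinimal] (p : ℕ) [Fact p.Prime]
    (hp : p ≠ 2) (hX : ClassX7 W p) (hap : W.frobeniusTrace p = 0) (hs : Surj W p)
    (hloc : ∃ (ℓ : ℕ) (_ : Fact ℓ.Prime), ℓ ≠ p ∧ W.HasMultiplicativeReductionAtPrime ℓ ∧
        ¬ W.HasSplitMultiplicativeReductionAtPrime ℓ ∧ ¬ p ∣ padicValInt ℓ W.minimalDiscriminantInt)
    (ε : ℤˣ) : KobayashiMainConjecture W p ε :=
  X7.kobayashiMainConjecture_of_thm451_OPEN_of_surj W p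
    (fouquetWan2021_thm451_via_kobayashi74_OPEN_of_facts hFW451 h12 h5 h3) hp hX hap hs hloc ε

end Summit.BirchSwinnertonDyer.BirchSwinnertonDyer.Theorems.KuriharaRigidity

end
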